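import Mathlib.LinearAlgebra.LinearIndependent.Defs
import Literature.Computability.AlgebraicComplexity.Forbes15ShiftedPartialsDefs
import HarnessLib

/-!
# Forbes 2015, §3.3 / §5.3 — trailing monomials under the operators `(x_i + α_i)·∂_{x_i}`

M. A. Forbes, *Deterministic divisibility testing via shifted partial derivatives*, FOCS 2015
(doi:10.1109/FOCS.2015.35; held `paper:doi-10-1109-focs-2015-35`), §3.3 (monomial-order
properties: Lemma 3.6 «the trailing monomial is homomorphic», Lemma 3.7 (derivatives),
Cor. 3.11 «polynomials with distinct trailing monomials are linearly independent»), §5.3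
Lemma 5.11 («relating `((x + α) ∘ ∂_x)` on `f(x + α)` to `∂_x` on `TM(f(x + α))`»).

Part 1 (of 4) of the proofs for the val-lit discharge of FSV 2018 Lemma 36 = Forbes 2015
Prop. 6.5 with `m = 1`; definitions in `Forbes15ShiftedPartialsDefs`.  All theorems.

* `linearIndependent_of_isTrailing` — Cor. 3.11 for an abstract rank.
* `IsTrailing.pderiv`, `IsTrailing.mul_of_coeff_zero_ne_zero`, `IsTrailing.monomial_mul` —
  Lemma 3.7 / Lemma 3.6 (trailing monomials of `∂_{x_i} f`, of `q·f` with `q(0) ≠ 0`, of `x^c·f`).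
* `IsTrailing.shiftDerivList` — Lemma 5.11 for the operators `(x+α)^{1_L}∂_{x^{1_L}}`: the
  trailing monomial of `shiftDerivList α L f` is `e − 1_L` when `L ⊆ Supp(e)` has no repetition,
  the exponents `e_i` (`i ∈ L`) are nonzero IN THE FIELD (Remark 4.16) and `α` is nonzero on `L`.
-/

open MvPolynomial
open Finsupp (single single_le_iff single_eq_same single_apply)

namespace Literature.Computability.AlgebraicComplexity.Forbes15

variable {σ F Λ : Type*} [Field F] [AddCommMonoid Λ] [LinearOrder Λ]

namespace IsTrailing

variable {r : (σ →₀ ℕ) →+ Λ} {f : MvPolynomial σ F} {e : σ →₀ ℕ}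

/-- A polynomial with a trailing monomial is nonzero. [cite: Forbes2015, §3.2] -/
theorem ne_zero (h : IsTrailing r f e) : f ≠ 0 := by
  rintro rfl
  exact h.1 (coeff_zero e)

/-- The trailing monomial lies in the support. [cite: Forbes2015, §3.2] -/
theorem mem_support (h : IsTrailing r f e) : e ∈ f.support :=
  MvPolynomial.mem_support_iff.mpr h.1

section Cancel

variable [IsOrderedCancelAddMonoid Λ]

/-- **Forbes Lemma 3.7 (trailing version, one variable, standard derivative):** if `e` is the
trailing monomial of `f` and the exponent `e i` is nonzero in the field, then `e - e_i` is the
trailing monomial of `∂_{x_i} f`. [cite: Forbes2015, Lemma 3.7 / Remark 4.16] -/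
theorem pderiv (h : IsTrailing r f e) (i : σ) (hei : (e i : F) ≠ 0) :
    IsTrailing r (MvPolynomial.pderiv i f) (e - single i 1) := by
  have hei' : 1 ≤ e i := Nat.one_le_iff_ne_zero.mpr (by rintro h0; exact hei (by simp [h0]))
  have hle : single i 1 ≤ e := single_le_iff.mpr hei'
  refine ⟨?_, fun d hd => ?_⟩
  · rw [coeff_pderiv, tsub_add_cancel_of_le hle]
    have h0 : (e - single i 1 : σ →₀ ℕ) i + 1 = e i := by
      rw [Finsupp.tsub_apply, single_eq_same]
      omega
    have h1 : ((((e - single i 1 : σ →₀ ℕ) i) : ℕ) : F) + 1 = (e i : F) := by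
      rw [← h0, Nat.cast_add, Nat.cast_one]
    rw [h1]
    exact mul_ne_zero h.1 hei
  · rw [MvPolynomial.mem_support_iff, coeff_pderiv] at hd
    have hd' : coeff (d + single i 1) f ≠ 0 := fun h0 => hd (by rw [h0, zero_mul])
    have h2 := h.2 _ (MvPolynomial.mem_support_iff.mpr hd')
    rw [← tsub_add_cancel_of_le hle, map_add, map_add] at h2
    exact le_of_add_le_add_right h2

omit [IsOrderedCancelAddMonoid Λ] in
/-- **Forbes Lemma 3.6 (trailing version):** multiplying by a polynomial with nonzero constant
term (e.g. `(x + α)^b` for a full-support `α`) does not change the trailing monomial; here `r`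
must be injective and monotone. [cite: Forbes2015, Lemma 3.6 / §5.3] -/
theorem mul_of_coeff_zero_ne_zero (hr : Function.Injective r) (hmono : Monotone r)
    (h : IsTrailing r f e) {q : MvPolynomial σ F} (hq : coeff 0 q ≠ 0) :
    IsTrailing r (q * f) e := by
  classical
  refine ⟨?_, fun d hd => ?_⟩
  · rw [coeff_mul, Finset.sum_eq_single (0, e)]
    · simpa using mul_ne_zero hq h.1
    · rintro ⟨x₁, x₂⟩ hx hne
      rw [Finset.mem_antidiagonal] at hx
      by_cases hx₂ : coeff x₂ f = 0
      · rw [hx₂, mul_zero]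
      · exfalso
        have hle : r x₂ ≤ r e := hmono (hx ▸ le_add_self)
        have hge : r e ≤ r x₂ := h.2 _ (MvPolynomial.mem_support_iff.mpr hx₂)
        have hx₂e : x₂ = e := hr (le_antisymm hle hge)
        subst hx₂e
        have hx₁ : x₁ = 0 := add_eq_right.mp hx
        exact hne (by rw [hx₁])
    · intro hne
      exact absurd (Finset.mem_antidiagonal.mpr (zero_add e)) hne
  · rw [MvPolynomial.mem_support_iff, coeff_mul] at hd
    obtain ⟨⟨x₁, x₂⟩, hx, hne⟩ := Finset.exists_ne_zero_of_sum_ne_zero hd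
    rw [Finset.mem_antidiagonal] at hx
    have hx₂ : coeff x₂ f ≠ 0 := fun h0 => hne (by rw [h0, mul_zero])
    exact (h.2 _ (MvPolynomial.mem_support_iff.mpr hx₂)).trans (hmono (hx ▸ le_add_self))

/-- Multiplying by the monomial `x^c` shifts the trailing monomial by `c`.
[cite: Forbes2015, Lemma 3.6] -/
theorem monomial_mul (h : IsTrailing r f e) (c : σ →₀ ℕ) :
    IsTrailing r (monomial c (1 : F) * f) (c + e) := by
  classical
  refine ⟨?_, fun d hd => ?_⟩
  · rw [coeff_monomial_mul', if_pos le_self_add, add_tsub_cancel_left, one_mul]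
    exact h.1
  · rw [MvPolynomial.mem_support_iff, coeff_monomial_mul'] at hd
    split_ifs at hd with hcd
    · rw [one_mul] at hd
      have := h.2 _ (MvPolynomial.mem_support_iff.mpr hd)
      calc r (c + e) = r c + r e := map_add r c e
        _ ≤ r c + r (d - c) := add_le_add_right this _
        _ = r (c + (d - c)) := (map_add r _ _).symm
        _ = r d := by rw [add_tsub_cancel_of_le hcd]
    · exact absurd rfl hd

end Cancel

end IsTrailing

/-- **Forbes Cor. 3.11 (trailing version): polynomials with pairwise distinct trailing monomials
are linearly independent.** [cite: Forbes2015, Cor. 3.11] -/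
theorem linearIndependent_of_isTrailing {ι : Type*} {r : (σ →₀ ℕ) →+ Λ}
    (hr : Function.Injective r) (v : ι → MvPolynomial σ F) (e : ι → σ →₀ ℕ)
    (he : Function.Injective e) (hv : ∀ i, IsTrailing r (v i) (e i)) :
    LinearIndependent F v := by
  classical
  rw [linearIndependent_iff']
  intro s g hsum
  by_contra hcon
  push Not at hcon
  obtain ⟨i₁, hi₁s, hgi₁⟩ := hcon
  set s' := s.filter fun i => g i ≠ 0 with hs'
  have hs'ne : s'.Nonempty := ⟨i₁, Finset.mem_filter.mpr ⟨hi₁s, hgi₁⟩⟩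
  obtain ⟨i₀, hi₀, hmin⟩ := Finset.exists_min_image s' (fun i => r (e i)) hs'ne
  rw [Finset.mem_filter] at hi₀
  have hcoeff := congrArg (coeff (e i₀)) hsum
  rw [coeff_sum, coeff_zero] at hcoeff
  rw [Finset.sum_eq_single i₀] at hcoeff
  · rw [coeff_smul, smul_eq_mul] at hcoeff
    exact (mul_ne_zero hi₀.2 (hv i₀).1) hcoeff
  · intro i hi hne
    rw [coeff_smul, smul_eq_mul]
    by_cases hgi : g i = 0
    · rw [hgi, zero_mul]
    · have hle := hmin i (Finset.mem_filter.mpr ⟨hi, hgi⟩)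
      have hne' : r (e i₀) ≠ r (e i) := fun h => hne (he (hr h)).symm
      have hlt : r (e i₀) < r (e i) := lt_of_le_of_ne hle hne'
      by_cases hsupp : e i₀ ∈ (v i).support
      · exact absurd ((hv i).2 _ hsupp) (not_le.mpr hlt)
      · rw [MvPolynomial.notMem_support_iff.mp hsupp, mul_zero]
  · intro h
    exact absurd hi₀.1 h

/-! ### `1_L` and the operators along a list -/

/-- `1_L` counts occurrences. [cite: Forbes2015, §5.2] -/
theorem listIndicator_apply [DecidableEq σ] (L : List σ) (i : σ) :
    listIndicator L i = L.count i := by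
  induction L with
  | nil => simp
  | cons j L ih =>
    simp only [listIndicator_cons, Finsupp.add_apply, ih, List.count_cons, single_apply,
      beq_iff_eq]
    split_ifs <;> omega

/-- `1_L` vanishes off `L`. [cite: Forbes2015, §5.2] -/
theorem listIndicator_apply_of_not_mem (L : List σ) {i : σ} (hi : i ∉ L) :
    listIndicator L i = 0 := by
  classical
  rw [listIndicator_apply, List.count_eq_zero_of_not_mem hi]

/-- `1_L` is `1` on a list without repetition. [cite: Forbes2015, §5.2] -/
theorem listIndicator_apply_of_mem_of_nodup (L : List σ) (hL : L.Nodup) {i : σ} (hi : i ∈ L) :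
    listIndicator L i = 1 := by
  classical
  rw [listIndicator_apply, List.count_eq_one_of_mem hL hi]

/-- The trailing coefficient of `x_i + α_i` is `α_i`. [cite: Forbes2015, §5.2] -/
theorem coeff_zero_X_add_C (i : σ) (a : F) : coeff 0 (X i + C a : MvPolynomial σ F) = a := by
  classical
  rw [coeff_add, coeff_C, if_pos rfl, coeff_zero_X, zero_add]

/-- **Forbes Lemma 5.11 (for the operators `(x+α)^{1_L}∂_{x^{1_L}}`):** if `e` is the trailing
monomial of `f`, `L` is a list of distinct variables whose exponents in `e` are nonzero in the
field, and `α` is nonzero on `L`, then `e - 1_L` is the trailing monomial of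
`shiftDerivList α L f`. [cite: Forbes2015, Lemma 5.11 / Lemma 4.13 / Remark 4.16] -/
theorem IsTrailing.shiftDerivList [IsOrderedCancelAddMonoid Λ] {r : (σ →₀ ℕ) →+ Λ}
    (hr : Function.Injective r)
    (hmono : Monotone r) (α : σ → F) {f : MvPolynomial σ F} {e : σ →₀ ℕ}
    (h : IsTrailing r f e) (L : List σ) (hL : L.Nodup) (hexp : ∀ i ∈ L, (e i : F) ≠ 0)
    (hα : ∀ i ∈ L, α i ≠ 0) :
    IsTrailing r (shiftDerivList α L f) (e - listIndicator L) := by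
  induction L with
  | nil => simpa using h
  | cons i L ih =>
    rw [List.nodup_cons] at hL
    have ih' := ih hL.2 (fun j hj => hexp j (List.mem_cons_of_mem i hj))
      (fun j hj => hα j (List.mem_cons_of_mem i hj))
    have hei : (((e - listIndicator L) i : ℕ) : F) ≠ 0 := by
      rw [Finsupp.tsub_apply, listIndicator_apply_of_not_mem L hL.1, Nat.sub_zero]
      exact hexp i (List.mem_cons_self ..)
    have h1 := ih'.pderiv i hei
    have h2 := h1.mul_of_coeff_zero_ne_zero hr hmono (q := X i + C (α i))
      (by rw [coeff_zero_X_add_C]; exact hα i (List.mem_cons_self ..))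
    rw [shiftDerivList_cons, shiftDeriv_apply, listIndicator_cons]
    convert h2 using 1
    rw [add_comm, tsub_tsub]

end Literature.Computability.AlgebraicComplexity.Forbes15
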